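import Summits.AtomisticToContinuum.HydrodynamicLimit.Theses.ImplosionDichotomy
import Summits.AtomisticToContinuum.HydrodynamicLimit.Theorems.HydroLimitInBand.Negative.ShearReduction
import Summits.AtomisticToContinuum.HydrodynamicLimit.Theorems.HydroLimitInBand.Negative.SigmaZero
import Summits.AtomisticToContinuum.HydrodynamicLimit.Theorems.HydroLimitInBand.Negative.LoadBearing
import Summits.AtomisticToContinuum.HydrodynamicLimit.Theorems.DenseExcursion.Negative.AtTimeZero
import Summits.AtomisticToContinuum.HydrodynamicLimit.Theorems.PolynomialCompression.Negative.PdeForm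
import Summits.AtomisticToContinuum.HydrodynamicLimit.Theorems.ImplosionDichotomyPolynomialCompression
import Literature.MathematicalPhysics.KineticTheory.HardSphereEulerSolutionGluing
import Literature.Analysis.FunctionSpaces.TorusSupNormContinuity
import Literature.Analysis.FunctionSpaces.HolderInterpolation
import HarnessLib

/-!
# STRATEGY-CENSUS lemmas — crux `HydroLimitProfilewiseBand` (stmt-AtomisticToContinuum-17372), route ImplosionDichotomy

Crux-strategist `planner-cstrat-stmt-AtomisticToContinuum-17372-s1-0`, 2026-08-16. Kernel-checked companions of
`Cruxes/HydroLimitProfilewiseBand/STRATEGY-CENSUS.md`. The crux is the PROFILE-WISE packing-guarded hydrodynamic limit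
(`∀ profiles ∃ η ∃ σ₀ …`), filed by the route-repair planner after the D-0032 statement re-type as the weakest hypothesis
that keeps `DiluteSelfConsistency` load-bearing in `closes : DiluteSelfConsistency → HydroLimitProfilewiseBand →
HydrodynamicLimit`. It differs from the sibling crux `HydroLimitInBand` (stmt-9133; SINCE THE RE-TYPE = the sub-problem
Statement VERBATIM, `inBand_iff_statement`) by one quantifier swap (`∀∃` instead of `∃∀` on the packing threshold).

What is proved here (all sorry-free):

* §1 QUANTIFIER ANATOMY. `BandBody η a₀ θ₀ u₀` = the common inner statement; `profilewise_iff` / `inBand_iff` (both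
  `Iff.rfl`); `bandBody_anti` (antitone in `η`).
* §2 STRENGTHEN is routine: `profilewise_of_inBand` (= the support item `ProfilewiseOfInBand`, stmt-17373),
  `inBand_iff_statement` (`Iff.rfl`: the sibling crux IS the Statement), `profilewise_of_statement`, `profilewise_of_unguarded`;
  TRANSFER from the sibling: `profilewise_of_heart : OneWindowLedger → WindowContinuity → LineInputs → HydroLimitProfilewiseBand`
  (one line over `hydroLimitInBand_of_heart`; kernel-checked in the evidence copy, quoted in a comment here — the live 9133 line
  `IdeatorOneSketch` is a line for THIS crux; its one open stub `stub_inputs` is the whole residue here too).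
* §3 INSIDE THE ROUTE'S OWN FRAME THE SWITCH IS VOID: `unguarded_of_dilute_of_profilewise` and the three equivalences
  `profilewise_iff_unguarded_of_dilute`, `profilewise_iff_inBand_of_dilute`, `profilewise_iff_statement_of_dilute` — under the
  route's other `closes` hypothesis `DiluteSelfConsistency` (stmt-3091) the crux, the sibling crux 9133 (= Statement) and the
  UNGUARDED Literature conjecture `KineticTheory.HydrodynamicLimit` are pairwise equivalent.
* §4 NEGATION FRONTIER IS SHARED: `shearHydroLimit_of_profilewise` — the crux implies the disprover's cheapest falsifier
  `ShearHydroLimit` of 9133 (stationary shear, packing `σ³`, inside every band).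
* §5 LOAD-BEARING TABLE TRANSFERS: `profilewiseWithoutGuard_iff` (guard dropped = the unguarded conjecture);
  `shearBandWithZero_false` / `profilewise_false_with_sigma_zero` (`0 < σ` relaxed to `0 ≤ σ` is FALSE, same free-streaming
  shear witness as `hydroLimitInBand_false_with_sigma_zero`, which factors through the same statement:
  `shearBandWithZero_of_inBandWithZero`); `not_profilewiseFor_of_witness` (the master witness lemma of
  `Negative/LoadBearing.lean` refutes the profile-wise shape over any solution class with the same homogeneous witnesses).
* §6 THE NATURAL PDE/PARTICLE DECOMPOSITION IS DEAD: `profilewise_of_split : DensityCappedLimit → GuardedDensityBound →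
  HydroLimitProfilewiseBand` (the glue) and `guardedDensityBound_false_of_polynomialCompression : PolynomialCompression →
  ¬ GuardedDensityBound` — the PDE-side child ("below a profile-wise packing threshold the density of tied classical
  solutions is σ-uniformly bounded") is REFUTED by the route's own PROVED rank-4 crux `PolynomialCompression` (stmt-12587,
  `polynomialCompression_proof`): restriction to the first time the packing reaches `η/2`, continuity of the sup norm in
  time, and the `t = 0` pinning `ρ₀ σ³ < (2e+1)M σ³`; UNCONDITIONAL corollary `guardedDensityBound_false : ¬ GuardedDensityBound`
  (imports the landed proof). Axioms of every theorem: propext, Classical.choice, Quot.sound.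
-/

noncomputable section

open MeasureTheory ProbabilityTheory Filter Set Topology Real
open scoped ENNReal NNReal InnerProductSpace

namespace Summit.AtomisticToContinuum.HydrodynamicLimit.Cruxes.HydroLimitProfilewiseBand.Census

open Literature.MathematicalPhysics.KineticTheory Literature.Analysis.FluidPDE
open Literature.Analysis.FunctionSpaces
open Summit.AtomisticToContinuum.HydrodynamicLimit.Theses.ImplosionDichotomy
open Summit.AtomisticToContinuum.HydrodynamicLimit.Theorems
open Summit.AtomisticToContinuum.HydrodynamicLimit.Theorems.HydroLimitInBandNegative
open Summit.AtomisticToContinuum.HydrodynamicLimit.Theorems.PolynomialCompressionPDE (Flows flows_nonempty)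
open Summit.AtomisticToContinuum.HydrodynamicLimit.Theorems.CorrectorPressureDecayNegative.FreeFlow (freeFlow₀)

/-! ## §1 Quantifier anatomy -/

/-- The common inner statement of the sibling crux `HydroLimitInBand` (stmt-9133) and of this crux, at packing
threshold `η` and profiles `(a₀, θ₀, u₀)`: `∃ σ₀ ∀ σ ∈ (0,σ₀) ∀ classical hs-Euler solutions with packing < η ∀ Φ,
LLN at 0 ⇒ LLN at every t < T`. -/
def BandBody (η : ℝ) (a₀ θ₀ : T3 → ℝ) (u₀ : T3 → V3) : Prop :=
  ∃ σ₀ : ℝ, 0 < σ₀ ∧ ∀ σ : ℝ, 0 < σ → σ < σ₀ →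
    ∀ (T : ℝ) (ρ θ : ℝ → T3 → ℝ) (u : ℝ → T3 → V3), IsHardSphereEulerSolution σ T ρ u θ →
    (∀ t ∈ Ico 0 T, ∀ x, ρ t x * σ ^ 3 < η) →
    ∀ Φ : Flows σ, TendstoHydroFieldsAt (fun N => localGibbsLaw σ a₀ u₀ θ₀ N (Φ N)) Φ ρ u θ 0 →
    ∀ t ∈ Ico 0 T, TendstoHydroFieldsAt (fun N => localGibbsLaw σ a₀ u₀ θ₀ N (Φ N)) Φ ρ u θ t

/-- The crux is `∀ profiles, ∃ η > 0, BandBody η profiles` (definitionally). -/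
theorem profilewise_iff :
    HydroLimitProfilewiseBand ↔ ∀ (a₀ θ₀ : T3 → ℝ) (u₀ : T3 → V3), Continuous a₀ → Continuous θ₀ →
      Continuous u₀ → (∀ x, 0 < a₀ x) → (∀ x, 0 < θ₀ x) → ∃ η : ℝ, 0 < η ∧ BandBody η a₀ θ₀ u₀ :=
  Iff.rfl

/-- The sibling crux is `∃ η₀ > 0, ∀ profiles, BandBody η₀ profiles` (definitionally). -/
theorem inBand_iff :
    HydroLimitInBand ↔ ∃ η₀ : ℝ, 0 < η₀ ∧ ∀ (a₀ θ₀ : T3 → ℝ) (u₀ : T3 → V3), Continuous a₀ → Continuous θ₀ →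
      Continuous u₀ → (∀ x, 0 < a₀ x) → (∀ x, 0 < θ₀ x) → BandBody η₀ a₀ θ₀ u₀ :=
  Iff.rfl

/-- The body is ANTITONE in the threshold: a smaller `η` guards fewer solutions. -/
theorem bandBody_anti {η η' : ℝ} (hle : η ≤ η') {a₀ θ₀ : T3 → ℝ} {u₀ : T3 → V3}
    (H : BandBody η' a₀ θ₀ u₀) : BandBody η a₀ θ₀ u₀ := by
  obtain ⟨σ₀, hσ₀, G⟩ := H
  exact ⟨σ₀, hσ₀, fun σ hσ hσ' T ρ θ u hE hg => G σ hσ hσ' T ρ θ u hE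
    (fun t ht x => (hg t ht x).trans_le hle)⟩

/-! ## §2 Strengthen: the uniform band (= the Statement) implies the crux, routinely -/

/-- **S⁺ ⇒ crux** (the content of the support item `ProfilewiseOfInBand`, stmt-17373): take `η := η₀`. -/
theorem profilewise_of_inBand (h : HydroLimitInBand) : HydroLimitProfilewiseBand := by
  obtain ⟨η₀, hη₀, H⟩ := h
  exact fun a₀ θ₀ u₀ ha hθ hu ha0 hθ0 => ⟨η₀, hη₀, H a₀ θ₀ u₀ ha hθ hu ha0 hθ0⟩

/-- The route's support item `ProfilewiseOfInBand` holds (census copy; the Theorems landing is a prover's). -/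
theorem profilewiseOfInBand_census : ProfilewiseOfInBand := profilewise_of_inBand

/-- **Since the D-0032 re-type the sibling crux IS the sub-problem Statement**, definitionally. -/
theorem inBand_iff_statement : HydroLimitInBand ↔ _root_.HydrodynamicLimit := Iff.rfl

/-- The Statement implies the crux. -/
theorem profilewise_of_statement (h : _root_.HydrodynamicLimit) : HydroLimitProfilewiseBand :=
  profilewise_of_inBand (inBand_iff_statement.2 h)

/-- The UNGUARDED Literature conjecture implies the crux (take `η := 1`, ignore the guard). -/
theorem profilewise_of_unguarded (h : Literature.MathematicalPhysics.KineticTheory.HydrodynamicLimit) :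
    HydroLimitProfilewiseBand := by
  intro a₀ θ₀ u₀ ha hθ hu ha0 hθ0
  obtain ⟨σ₀, hσ₀, H⟩ := h a₀ θ₀ u₀ ha hθ hu ha0 hθ0
  exact ⟨1, one_pos, σ₀, hσ₀, fun σ hσ hσ' T ρ θ u hE _ Φ h0 => H σ hσ hσ' T ρ θ u hE Φ h0⟩

/-! ### Transfer from the sibling crux: the live 9133 line IS a line for this crux

The registered skeleton `Cruxes/HydroLimitInBand/Lines/IdeatorOneSketch.lean` is closed in the tree as
`HydroLimitInBandOfHeart.hydroLimitInBand_of_heart : OneWindowLedger → WindowContinuity → LineInputs → HydroLimitInBand` (p122696;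
`WindowContinuity` landed p118327, the heart's two clauses p123605 / p127017, one open stub `stub_inputs : LineInputs` = the five
conjecture-grade inputs KCWF ∧ LCTF ∧ CSCV-W ∧ TAT(⊇ CAT ∧ CEAT) ∧ ECT). Composing with `profilewise_of_inBand` gives the same reduction for
this crux — nothing profile-wise-specific remains to build:

  `theorem profilewise_of_heart (hW : HydroLimitInBandOfHeart.OneWindowLedger) (hC : HydroLimitInBandOfHeart.WindowContinuity)`
  `    (hI : HydroLimitInBandOfHeart.LineInputs) : HydroLimitProfilewiseBand :=`
  `  profilewise_of_inBand (HydroLimitInBandOfHeart.hydroLimitInBand_of_heart hW hC hI)`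

(kernel-checked rc 0 in the evidence copy `Census.lean` on stmt-17372, which imports `…Theorems.ImplosionDichotomyHydroLimitInBandOfHeart`;
left out of this crux-dir copy only to keep its import closure small while the farm was incoherent on a module of that closure). -/

/-! ## §3 Inside the route's own frame the `∀∃ / ∃∀` switch is void -/

/-- **`DiluteSelfConsistency` upgrades the crux to the UNGUARDED conjecture** (the body of the route's `closes`,
rev 11, before its final `HydrodynamicLimit.of_unguarded`): admissible solutions become arbitrarily dilute as `σ → 0`,
so the profile-dependent threshold is eventually met. -/
theorem unguarded_of_dilute_of_profilewise (hD : DiluteSelfConsistency) (hP : HydroLimitProfilewiseBand) :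
    Literature.MathematicalPhysics.KineticTheory.HydrodynamicLimit := by
  intro a₀ θ₀ u₀ ha hθ hu ha0 hθ0
  obtain ⟨η, hη, σ₁, hσ₁, G⟩ := hP a₀ θ₀ u₀ ha hθ hu ha0 hθ0
  obtain ⟨σ₂, hσ₂, D⟩ := hD η hη a₀ θ₀ u₀ ha hθ hu ha0 hθ0
  refine ⟨min σ₁ σ₂, lt_min hσ₁ hσ₂, ?_⟩
  intro σ hσ hσlt T ρ θ u hE Φ h0 t ht
  exact G σ hσ (lt_of_lt_of_le hσlt (min_le_left _ _)) T ρ θ u hE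
    (fun s hs x => D σ hσ (lt_of_lt_of_le hσlt (min_le_right _ _)) T ρ θ u hE Φ h0 s hs x) Φ h0 t ht

/-- Under `DiluteSelfConsistency` the crux is EQUIVALENT to the unguarded Literature conjecture. -/
theorem profilewise_iff_unguarded_of_dilute (hD : DiluteSelfConsistency) :
    HydroLimitProfilewiseBand ↔ Literature.MathematicalPhysics.KineticTheory.HydrodynamicLimit :=
  ⟨unguarded_of_dilute_of_profilewise hD, profilewise_of_unguarded⟩

/-- Under `DiluteSelfConsistency` the crux is EQUIVALENT to the Statement. -/
theorem profilewise_iff_statement_of_dilute (hD : DiluteSelfConsistency) :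
    HydroLimitProfilewiseBand ↔ _root_.HydrodynamicLimit :=
  ⟨fun h => HydrodynamicLimit.of_unguarded (unguarded_of_dilute_of_profilewise hD h), profilewise_of_statement⟩

/-- Under `DiluteSelfConsistency` the crux is EQUIVALENT to the sibling crux `HydroLimitInBand` (stmt-9133). -/
theorem profilewise_iff_inBand_of_dilute (hD : DiluteSelfConsistency) :
    HydroLimitProfilewiseBand ↔ HydroLimitInBand :=
  (profilewise_iff_statement_of_dilute hD).trans inBand_iff_statement.symm

/-- Under `DiluteSelfConsistency` the sibling crux (= Statement) is itself equivalent to the unguarded conjecture. -/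
theorem inBand_iff_unguarded_of_dilute (hD : DiluteSelfConsistency) :
    HydroLimitInBand ↔ Literature.MathematicalPhysics.KineticTheory.HydrodynamicLimit :=
  (profilewise_iff_inBand_of_dilute hD).symm.trans (profilewise_iff_unguarded_of_dilute hD)

/-! ## §4 Negation: the falsifier frontier is shared with the sibling crux -/

/-- **The crux implies `ShearHydroLimit`** (the standing disprover's cheapest concrete falsifier of stmt-9133,
`Negative/ShearReduction.lean`): instantiate the crux at the shear profiles `(1, sin(2π x₁) e₀, 1)`, where the
stationary shear is a classical admissible solution on every `[0,T)` with packing `σ³ < η` once `σ < min 1 (η/2)`.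
So an MD failure of the shear LLN at one time for arbitrarily small `σ` kills THIS crux too. -/
theorem shearHydroLimit_of_profilewise (h : HydroLimitProfilewiseBand) : ShearHydroLimit := by
  obtain ⟨η₀, hη₀, σ₀, hσ₀, G⟩ := h (fun _ => 1) (fun _ => 1) shearVelocity continuous_const continuous_const
    continuous_shearVelocity (fun _ => one_pos) (fun _ => one_pos)
  obtain ⟨σ₁, hσ₁, -, S⟩ := shear_tied
  refine ⟨min σ₀ (min σ₁ (min 1 (η₀ / 2))),
    lt_min hσ₀ (lt_min hσ₁ (lt_min one_pos (by positivity))), fun σ hσ hσlt Φ t ht => ?_⟩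
  have hσ₀' : σ < σ₀ := lt_of_lt_of_le hσlt (min_le_left _ _)
  have hσ₁' : σ < σ₁ := lt_of_lt_of_le hσlt ((min_le_right _ _).trans (min_le_left _ _))
  have hσ1 : σ < 1 := lt_of_lt_of_le hσlt ((min_le_right _ _).trans ((min_le_right _ _).trans (min_le_left _ _)))
  have hση : σ < η₀ / 2 :=
    lt_of_lt_of_le hσlt ((min_le_right _ _).trans ((min_le_right _ _).trans (min_le_right _ _)))
  have hcube : σ ^ 3 ≤ σ := by
    have := pow_le_pow_of_le_one hσ.le hσ1.le (show 1 ≤ 3 by norm_num)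
    simpa using this
  have hguard : ∀ s ∈ Ico (0 : ℝ) (t + 1), ∀ x : T3, (1 : ℝ) * σ ^ 3 < η₀ := by
    intro s _ x; linarith
  exact G σ hσ hσ₀' (t + 1) _ _ _ (isHardSphereEulerSolution_shear σ (t + 1)) hguard Φ (S σ hσ hσ₁' Φ) t
    ⟨ht, by linarith⟩

/-! ## §5 The load-bearing table of the sibling crux transfers -/

/-- The crux with the packing GUARD dropped (the `∃ η` prefix then quantifies nothing). -/
def ProfilewiseWithoutGuard : Prop :=
  ∀ (a₀ θ₀ : T3 → ℝ) (u₀ : T3 → V3), Continuous a₀ → Continuous θ₀ → Continuous u₀ →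
    (∀ x, 0 < a₀ x) → (∀ x, 0 < θ₀ x) → ∃ η : ℝ, 0 < η ∧ ∃ σ₀ : ℝ, 0 < σ₀ ∧ ∀ σ : ℝ, 0 < σ → σ < σ₀ →
    ∀ (T : ℝ) (ρ θ : ℝ → T3 → ℝ) (u : ℝ → T3 → V3), IsHardSphereEulerSolution σ T ρ u θ →
    ∀ Φ : Flows σ, TendstoHydroFieldsAt (fun N => localGibbsLaw σ a₀ u₀ θ₀ N (Φ N)) Φ ρ u θ 0 →
    ∀ t ∈ Ico 0 T, TendstoHydroFieldsAt (fun N => localGibbsLaw σ a₀ u₀ θ₀ N (Φ N)) Φ ρ u θ t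

/-- **Without the guard the crux is the UNGUARDED Literature conjecture** `KineticTheory.HydrodynamicLimit`
(NOT the re-typed Statement: after D-0032 the sibling's `hydroLimitInBandWithoutGuard_iff … ↔ _root_.HydrodynamicLimit`
reads "`↔` the guarded Statement", which is the pre-retype text — noted for the 9133 disprover). -/
theorem profilewiseWithoutGuard_iff :
    ProfilewiseWithoutGuard ↔ Literature.MathematicalPhysics.KineticTheory.HydrodynamicLimit := by
  constructor
  · intro h a₀ θ₀ u₀ ha hθ hu ha0 hθ0
    obtain ⟨-, -, σ₀, hσ₀, H⟩ := h a₀ θ₀ u₀ ha hθ hu ha0 hθ0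
    exact ⟨σ₀, hσ₀, H⟩
  · intro h a₀ θ₀ u₀ ha hθ hu ha0 hθ0
    obtain ⟨σ₀, hσ₀, H⟩ := h a₀ θ₀ u₀ ha hθ hu ha0 hθ0
    exact ⟨1, one_pos, σ₀, hσ₀, H⟩

/-- The inner statement of BOTH cruxes at the SHEAR profiles with `0 < σ` relaxed to `0 ≤ σ`: the common core
through which `hydroLimitInBand_false_with_sigma_zero` (p123377) and its profile-wise twin below factor. -/
def ShearBandWithZero : Prop :=
  ∃ η : ℝ, 0 < η ∧ ∃ σ₀ : ℝ, 0 < σ₀ ∧ ∀ σ : ℝ, 0 ≤ σ → σ < σ₀ →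
    ∀ (T : ℝ) (ρ θ : ℝ → T3 → ℝ) (u : ℝ → T3 → V3), IsHardSphereEulerSolution σ T ρ u θ →
    (∀ t ∈ Ico 0 T, ∀ x, ρ t x * σ ^ 3 < η) →
    ∀ Φ : (N : ℕ) → HardSphereFlow (Torus.geometry (Fin 3)) (hsDiameter σ N) (N + 1),
    TendstoHydroFieldsAt (fun N => localGibbsLaw σ (fun _ => 1) shearVelocity (fun _ => 1) N (Φ N)) Φ ρ u θ 0 →
    ∀ t ∈ Ico 0 T,
      TendstoHydroFieldsAt (fun N => localGibbsLaw σ (fun _ => 1) shearVelocity (fun _ => 1) N (Φ N)) Φ ρ u θ t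

/-- The crux with `0 < σ` relaxed to `0 ≤ σ` (everything else verbatim). -/
def ProfilewiseWithZero : Prop :=
  ∀ (a₀ θ₀ : T3 → ℝ) (u₀ : T3 → V3), Continuous a₀ → Continuous θ₀ → Continuous u₀ →
    (∀ x, 0 < a₀ x) → (∀ x, 0 < θ₀ x) → ∃ η : ℝ, 0 < η ∧ ∃ σ₀ : ℝ, 0 < σ₀ ∧ ∀ σ : ℝ, 0 ≤ σ → σ < σ₀ →
    ∀ (T : ℝ) (ρ θ : ℝ → T3 → ℝ) (u : ℝ → T3 → V3), IsHardSphereEulerSolution σ T ρ u θ →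
    (∀ t ∈ Ico 0 T, ∀ x, ρ t x * σ ^ 3 < η) →
    ∀ Φ : (N : ℕ) → HardSphereFlow (Torus.geometry (Fin 3)) (hsDiameter σ N) (N + 1),
    TendstoHydroFieldsAt (fun N => localGibbsLaw σ a₀ u₀ θ₀ N (Φ N)) Φ ρ u θ 0 →
    ∀ t ∈ Ico 0 T, TendstoHydroFieldsAt (fun N => localGibbsLaw σ a₀ u₀ θ₀ N (Φ N)) Φ ρ u θ t

/-- The relaxed statement contains the crux (so `¬ ProfilewiseWithZero` is the strongest form of "`0 < σ` is
load-bearing" for this crux). -/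
theorem profilewise_of_withZero (h : ProfilewiseWithZero) : HydroLimitProfilewiseBand := by
  intro a₀ θ₀ u₀ ha hθ hu ha0 hθ0
  obtain ⟨η, hη, σ₀, hσ₀, G⟩ := h a₀ θ₀ u₀ ha hθ hu ha0 hθ0
  exact ⟨η, hη, σ₀, hσ₀, fun σ hσ hσ' => G σ hσ.le hσ'⟩

/-- The relaxed crux specialises to the shear core. -/
theorem shearBandWithZero_of_profilewiseWithZero (h : ProfilewiseWithZero) : ShearBandWithZero :=
  h (fun _ => 1) (fun _ => 1) shearVelocity continuous_const continuous_const continuous_shearVelocity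
    (fun _ => one_pos) (fun _ => one_pos)

/-- The sibling's relaxed crux `HydroLimitInBandWithZero` (9133 with `0 ≤ σ`) specialises to the same core. -/
theorem shearBandWithZero_of_inBandWithZero (h : HydroLimitInBandWithZero) : ShearBandWithZero := by
  obtain ⟨η₀, hη₀, H⟩ := h
  exact ⟨η₀, hη₀, H (fun _ => 1) (fun _ => 1) shearVelocity continuous_const continuous_const
    continuous_shearVelocity (fun _ => one_pos) (fun _ => one_pos)⟩

/-- **The shear core with `0 ≤ σ` is FALSE** — adapted verbatim from `hydroLimitInBand_false_with_sigma_zero`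
(`Negative/SigmaZero.lean`, p123377): at `σ = 0` the stationary shear is a guarded classical solution tied to the
product data, the free flight `freeFlow₀` is a flow family of diameter `0`, and free streaming sends the shear momentum
field to `e^{-2π²}/2 ≠ 1/2` at `t = 1`. -/
theorem shearBandWithZero_false : ¬ ShearBandWithZero := by
  rintro ⟨η₀, hη₀, σ₀, hσ₀, G⟩
  have hE := isHardSphereEulerSolution_shear 0 2
  have hguard : ∀ s ∈ Ico (0 : ℝ) 2, ∀ x : T3, (fun (_ : ℝ) (_ : T3) => (1 : ℝ)) s x * (0 : ℝ) ^ 3 < η₀ :=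
    fun _ _ _ => by simpa using hη₀
  have h0 := tendstoHydroFieldsAt_zero_sigma_zero (θ₀ := fun _ => 1) (u₀ := shearVelocity) continuous_const
    continuous_shearVelocity (fun _ => one_pos) freeFlow₀
  have h1 := G 0 le_rfl hσ₀ 2 (fun _ _ => 1) (fun _ _ => 1) (fun _ x => shearVelocity x) hE hguard freeFlow₀ h0 1
    ⟨by norm_num, by norm_num⟩
  set I : V3 := ∫ x : T3, (shearProfile x * (1 : ℝ)) • shearVelocity x with hI
  have hI0 : I 0 = 1 / 2 := integral_shear_momentum_target_zero
  have hconv : ∀ δ > (0 : ℝ), Tendsto (fun N : ℕ => localGibbsMeasure 0 (fun _ => 1) shearVelocity (fun _ => 1) N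
      {z | δ < |empiricalMomentumField (freeFlight (Torus.geometry (Fin 3)) 1 z) shearProfile 0 - 1 / 2|})
      atTop (𝓝 0) := by
    intro δ hδ
    obtain ⟨-, hm, -⟩ := h1 shearProfile continuous_shearProfile δ hδ
    refine tendsto_of_tendsto_of_tendsto_of_le_of_le tendsto_const_nhds hm (fun N => bot_le) (fun N => ?_)
    beta_reduce
    rw [localGibbsLaw_eq]
    refine measure_mono fun z hz => ?_
    simp only [mem_setOf_eq] at hz
    show δ < ‖empiricalMomentumField (freeFlight (Torus.geometry (Fin 3)) 1 z) shearProfile - I‖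
    calc δ < |empiricalMomentumField (freeFlight (Torus.geometry (Fin 3)) 1 z) shearProfile 0 - 1 / 2| := hz
      _ = |(empiricalMomentumField (freeFlight (Torus.geometry (Fin 3)) 1 z) shearProfile - I) 0| := by
          rw [PiLp.sub_apply, hI0]
      _ ≤ _ := by
          have h := PiLp.norm_apply_le
            (empiricalMomentumField (freeFlight (Torus.geometry (Fin 3)) 1 z) shearProfile - I) 0
          rwa [Real.norm_eq_abs] at h
  have hK : ∀ δ > (0 : ℝ), Tendsto (fun N : ℕ => localGibbsMeasure 0 (fun _ => 1) shearVelocity (fun _ => 1) N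
      {z | δ < |empiricalMomentumField (freeFlight (Torus.geometry (Fin 3)) 1 z) shearProfile 0 -
        Real.exp (-(2 * π ^ 2 * 1 ^ 2)) * (1 / 2)|}) atTop (𝓝 0) := fun δ hδ => tendsto_momentum_freeStream 1 hδ
  have hP : ∀ᶠ N : ℕ in atTop,
      IsProbabilityMeasure (localGibbsMeasure 0 (fun _ => (1 : ℝ)) shearVelocity (fun _ => 1) N) :=
    Eventually.of_forall fun N => isProbabilityMeasure_localGibbsMeasure continuous_const continuous_const
      continuous_shearVelocity (fun _ => one_pos) (fun _ => one_pos) (by norm_num) N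
  have heq := DenseExcursionAtTimeZero.eq_of_tendsto_measure_lt_abs hP
    (F := fun N z => empiricalMomentumField (freeFlight (Torus.geometry (Fin 3)) 1 z) shearProfile 0) hconv hK
  have hlt : Real.exp (-(2 * π ^ 2 * 1 ^ 2)) < 1 := by
    rw [Real.exp_lt_one_iff]
    have hπ := Real.pi_pos
    nlinarith
  have h2 : Real.exp (-(2 * π ^ 2 * 1 ^ 2)) = 1 := by linear_combination (-2 : ℝ) * heq
  exact absurd h2 hlt.ne

/-- **TIGHTNESS OF `0 < σ` for this crux**: the crux with `0 ≤ σ` is FALSE (collisions are load-bearing; any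
proof must use `0 < σ` quantitatively; thresholds of every input must be allowed to blow up as `σ ↓ 0`). -/
theorem profilewise_false_with_sigma_zero : ¬ ProfilewiseWithZero :=
  fun h => shearBandWithZero_false (shearBandWithZero_of_profilewiseWithZero h)

/-- The sibling's kill `hydroLimitInBand_false_with_sigma_zero` re-derived through the shared core. -/
theorem inBand_false_with_sigma_zero' : ¬ HydroLimitInBandWithZero :=
  fun h => shearBandWithZero_false (shearBandWithZero_of_inBandWithZero h)

/-- **The profile-wise crux shape over a solution class `Sol`** (the crux with `IsHardSphereEulerSolution` replaced by
`Sol`; cf. the sibling's `InBandFor`). -/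
def ProfilewiseFor (Sol : SolClass) : Prop :=
  ∀ (a₀ θ₀ : T3 → ℝ) (u₀ : T3 → V3), Continuous a₀ → Continuous θ₀ → Continuous u₀ →
    (∀ x, 0 < a₀ x) → (∀ x, 0 < θ₀ x) → ∃ η : ℝ, 0 < η ∧ ∃ σ₀ : ℝ, 0 < σ₀ ∧ ∀ σ : ℝ, 0 < σ → σ < σ₀ →
    ∀ (T : ℝ) (ρ θ : ℝ → T3 → ℝ) (u : ℝ → T3 → V3), Sol σ T ρ u θ →
    (∀ t ∈ Ico 0 T, ∀ x, ρ t x * σ ^ 3 < η) →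
    ∀ Φ : Flows σ, TendstoHydroFieldsAt (fun N => localGibbsLaw σ a₀ u₀ θ₀ N (Φ N)) Φ ρ u θ 0 →
    ∀ t ∈ Ico 0 T, TendstoHydroFieldsAt (fun N => localGibbsLaw σ a₀ u₀ θ₀ N (Φ N)) Φ ρ u θ t

/-- The crux is `ProfilewiseFor IsHardSphereEulerSolution` (definitionally). -/
theorem profilewise_iff_profilewiseFor : HydroLimitProfilewiseBand ↔ ProfilewiseFor IsHardSphereEulerSolution :=
  Iff.rfl

/-- The uniform shape implies the profile-wise shape over every solution class. -/
theorem profilewiseFor_of_inBandFor {Sol : SolClass} (h : InBandFor Sol) : ProfilewiseFor Sol := by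
  obtain ⟨η₀, hη₀, H⟩ := h
  exact fun a₀ θ₀ u₀ ha hθ hu ha0 hθ0 => ⟨η₀, hη₀, H a₀ θ₀ u₀ ha hθ hu ha0 hθ0⟩

/-- **Master refutation lemma, profile-wise shape** — the SAME witness hypothesis `W` as the sibling's
`not_inBandFor_of_witness` (homogeneous data `(1,0,1)`, packing `< η₀` for EVERY `η₀`, a non-constant continuous slice)
refutes `ProfilewiseFor Sol` as well: the witness profiles are fixed before `η` is chosen. Hence each of the five
`hydroLimitInBand_false_without_{mass,momentum,energy,smooth,tie}` witnesses of `Negative/LoadBearing{,II}.lean`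
refutes the corresponding profile-wise drop (their `W`s are inlined there; exposing them as named lemmas makes the five
instances one-liners). -/
theorem not_profilewiseFor_of_witness {Sol : SolClass}
    (W : ∀ η₀ : ℝ, 0 < η₀ → ∀ σ₁ : ℝ, 0 < σ₁ → ∃ σ : ℝ, 0 < σ ∧ σ < σ₁ ∧
      ∃ (T : ℝ) (ρ θ : ℝ → T3 → ℝ) (u : ℝ → T3 → V3), Sol σ T ρ u θ ∧
        (∀ t ∈ Ico 0 T, ∀ x, ρ t x * σ ^ 3 < η₀) ∧
        ρ 0 = (fun _ => 1) ∧ u 0 = (fun _ => 0) ∧ θ 0 = (fun _ => 1) ∧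
        ∃ t ∈ Ico 0 T, Continuous (ρ t) ∧ Continuous (u t) ∧ Continuous (θ t) ∧
          ¬ (ρ t = (fun _ => 1) ∧ u t = (fun _ => 0) ∧ θ t = (fun _ => 1))) :
    ¬ ProfilewiseFor Sol := by
  intro H
  obtain ⟨η₀, hη₀, σ₀, hσ₀, G⟩ := H (fun _ => 1) (fun _ => 1) (fun _ => 0) continuous_const continuous_const
    continuous_const (fun _ => one_pos) (fun _ => one_pos)
  obtain ⟨σ₁, hσ₁, hσ₁2, P⟩ := equilibrium_package (a := 1) (θc := 1) (0 : V3) one_pos one_pos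
  obtain ⟨σ, hσ, hσlt, T, ρ, θ, u, hSol, hguard, h1, h2, h3, t, ht, hρc, huc, hθc, hne⟩ :=
    W η₀ hη₀ (min σ₀ σ₁) (lt_min hσ₀ hσ₁)
  have hσ₀' : σ < σ₀ := lt_of_lt_of_le hσlt (min_le_left _ _)
  have hσ₁' : σ < σ₁ := lt_of_lt_of_le hσlt (min_le_right _ _)
  obtain ⟨Φ⟩ := flows_nonempty hσ (hσ₁'.trans_le hσ₁2)
  obtain ⟨-, htie, hrig⟩ := P σ hσ hσ₁' Φ
  have h0 := htie ρ θ u h1 h2 h3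
  have hT := G σ hσ hσ₀' T ρ θ u hSol hguard Φ h0 t ht
  exact hne (hrig ρ θ u t hρc huc hθc hT)

/-! ## §6 Decomposition: the natural PDE / particle split of the crux is dead -/

/-- **Child A** (particle side): the hydrodynamic limit along classical solutions of `σ`-UNIFORMLY BOUNDED DENSITY —
profile-wise, for every density cap `R` a threshold `σ₀(profiles, R)`. (The shape of the `DensityCap`-type cruxes of
other routes; packing `≤ R σ³ → 0`, i.e. genuinely dilute in packing but still at fixed reduced density.) -/
def DensityCappedLimit : Prop :=
  ∀ (a₀ θ₀ : T3 → ℝ) (u₀ : T3 → V3), Continuous a₀ → Continuous θ₀ → Continuous u₀ →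
    (∀ x, 0 < a₀ x) → (∀ x, 0 < θ₀ x) → ∀ R : ℝ, ∃ σ₀ : ℝ, 0 < σ₀ ∧ ∀ σ : ℝ, 0 < σ → σ < σ₀ →
    ∀ (T : ℝ) (ρ θ : ℝ → T3 → ℝ) (u : ℝ → T3 → V3), IsHardSphereEulerSolution σ T ρ u θ →
    (∀ t ∈ Ico 0 T, ∀ x, ρ t x ≤ R) →
    ∀ Φ : Flows σ, TendstoHydroFieldsAt (fun N => localGibbsLaw σ a₀ u₀ θ₀ N (Φ N)) Φ ρ u θ 0 →
    ∀ t ∈ Ico 0 T, TendstoHydroFieldsAt (fun N => localGibbsLaw σ a₀ u₀ θ₀ N (Φ N)) Φ ρ u θ t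

/-- **Child B** (PDE side): below a PROFILE-WISE packing threshold `η` the density of every tied classical solution is
`σ`-uniformly bounded by some `R(profiles)`. This is what would let the profile-wise `η` buy something: it would confine
the guarded class to bounded compressions. -/
def GuardedDensityBound : Prop :=
  ∀ (a₀ θ₀ : T3 → ℝ) (u₀ : T3 → V3), Continuous a₀ → Continuous θ₀ → Continuous u₀ →
    (∀ x, 0 < a₀ x) → (∀ x, 0 < θ₀ x) → ∃ η : ℝ, 0 < η ∧ ∃ R : ℝ, ∃ σ₀ : ℝ, 0 < σ₀ ∧
    ∀ σ : ℝ, 0 < σ → σ < σ₀ →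
    ∀ (T : ℝ) (ρ θ : ℝ → T3 → ℝ) (u : ℝ → T3 → V3), IsHardSphereEulerSolution σ T ρ u θ →
    (∀ t ∈ Ico 0 T, ∀ x, ρ t x * σ ^ 3 < η) →
    ∀ Φ : Flows σ, TendstoHydroFieldsAt (fun N => localGibbsLaw σ a₀ u₀ θ₀ N (Φ N)) Φ ρ u θ 0 →
    ∀ t ∈ Ico 0 T, ∀ x, ρ t x ≤ R

/-- **The glue of the split**: `DensityCappedLimit → GuardedDensityBound → HydroLimitProfilewiseBand`. -/
theorem profilewise_of_split (hA : DensityCappedLimit) (hB : GuardedDensityBound) :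
    HydroLimitProfilewiseBand := by
  intro a₀ θ₀ u₀ ha hθ hu ha0 hθ0
  obtain ⟨η, hη, R, σB, hσB, B⟩ := hB a₀ θ₀ u₀ ha hθ hu ha0 hθ0
  obtain ⟨σA, hσA, A⟩ := hA a₀ θ₀ u₀ ha hθ hu ha0 hθ0 R
  refine ⟨η, hη, min σA σB, lt_min hσA hσB, fun σ hσ hσlt T ρ θ u hE hguard Φ h0 t ht => ?_⟩
  have hσA' : σ < σA := lt_of_lt_of_le hσlt (min_le_left _ _)
  have hσB' : σ < σB := lt_of_lt_of_le hσlt (min_le_right _ _)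
  exact A σ hσ hσA' T ρ θ u hE (fun s hs x => B σ hσ hσB' T ρ θ u hE hguard Φ h0 s hs x) Φ h0 t ht

/-- **Child B is FALSE, by the route's own PROVED crux `PolynomialCompression`** (stmt-12587). For its profiles, at
arbitrarily small `σ`, a tied classical solution reaches density `σ^{-κ} → ∞`. Either its running sup-density never
reaches the guard level `η/(2σ³)` up to that time — then a guarded restriction contains the point of density
`σ^{-κ} > R` — or it does, at a first time `s_g > 0` (the `t = 0` packing is `< (2e+1)Mσ³ < η/2`); the restriction to
`[0, s_g)` is guarded and, by continuity of the sup norm in time, carries densities `> η/(2σ³) − 1 > R` just before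
`s_g`. Both contradict the bound `R`. -/
theorem guardedDensityBound_false_of_polynomialCompression (hPC : PolynomialCompression) :
    ¬ GuardedDensityBound := by
  intro hB
  obtain ⟨κ, hκ, a₀, θ₀, u₀, ha, hθ, hu, ha0, hθ0, H⟩ := hPC
  obtain ⟨η, hη, R, σ₀, hσ₀, B⟩ := hB a₀ θ₀ u₀ ha hθ hu ha0 hθ0
  obtain ⟨σ₁, hσ₁, hσ₁2, D⟩ := DenseExcursionAtTimeZero.density_zero_eq_rhoLim ha hθ hu ha0 hθ0
  set P := profileOf a₀ ha ha0 with hP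
  set K : ℝ := (2 * Real.exp 1 + 1) * P.M with hK
  have hK0 : 0 < K := by have := P.M_pos; positivity
  set R' : ℝ := max R 0 with hR'
  have hR'0 : 0 ≤ R' := le_max_right _ _
  have hRR' : R ≤ R' := le_max_left _ _
  -- an `rpow` threshold: `σ^(-κ) > R' + 1` for small `σ`
  obtain ⟨c, hc, hcpow⟩ : ∃ c : ℝ, 0 < c ∧ ∀ σ : ℝ, 0 < σ → σ < c → R' + 1 < σ ^ (-κ) := by
    have hlim := tendsto_rpow_neg_nhdsGT_zero (y := -κ) (by linarith)
    have hev : ∀ᶠ σ in 𝓝[>] (0 : ℝ), R' + 1 < σ ^ (-κ) := hlim.eventually_gt_atTop _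
    obtain ⟨c, hc, hsub⟩ := mem_nhdsGT_iff_exists_Ioo_subset.1 hev
    exact ⟨c, hc, fun σ hσ hσc => hsub ⟨hσ, hσc⟩⟩
  -- choose `σ`
  have hpos : 0 < min σ₀ (min σ₁ (min 1 (min (η / (2 * K)) (min (η / (2 * (R' + 1))) c)))) := by
    simp only [lt_min_iff]
    exact ⟨hσ₀, hσ₁, one_pos, by positivity, by positivity, hc⟩
  obtain ⟨σ, hσ, hσlt, T, ρ, θ, u, hE, hA, t, ht, x₀, hx₀⟩ := H _ hpos
  simp only [lt_min_iff] at hσlt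
  obtain ⟨hσσ₀, hσσ₁, hσ1, hσK, hσR, hσc⟩ := hσlt
  have hσ2 : σ < 1 / 2 := hσσ₁.trans_le hσ₁2
  have hσ3pos : 0 < σ ^ 3 := by positivity
  have hσ3le : σ ^ 3 ≤ σ := by
    have := pow_le_pow_of_le_one hσ.le hσ1.le (show 1 ≤ 3 by norm_num)
    simpa using this
  -- the guard level in density units
  set L : ℝ := η / 2 / σ ^ 3 with hL
  have hKL : K < L := by
    rw [hL, lt_div_iff₀ hσ3pos]
    have h1 : K * σ < η / 2 := by
      have := (lt_div_iff₀ (by positivity : (0:ℝ) < 2 * K)).1 hσK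
      linarith
    calc K * σ ^ 3 ≤ K * σ := by gcongr
      _ < η / 2 := h1
  have hRL : R' + 1 < L := by
    rw [hL, lt_div_iff₀ hσ3pos]
    have h1 : (R' + 1) * σ < η / 2 := by
      have := (lt_div_iff₀ (by positivity : (0:ℝ) < 2 * (R' + 1))).1 hσR
      linarith
    calc (R' + 1) * σ ^ 3 ≤ (R' + 1) * σ := by gcongr
      _ < η / 2 := h1
  have hpow : R' + 1 < σ ^ (-κ) := hcpow σ hσ hσc
  -- a flow family and the tie through it
  obtain ⟨Φ⟩ := flows_nonempty hσ hσ2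
  have h0Φ := hA Φ
  have hT0 : 0 < T := ht.1.trans_lt ht.2
  have h0mem : (0 : ℝ) ∈ Ico 0 T := ⟨le_rfl, hT0⟩
  -- time-zero density is pinned and bounded by `K`
  obtain ⟨hS, D'⟩ := D σ hσ hσσ₁
  have hρ0 : ρ 0 = rhoLim P σ :=
    D' ρ θ u Φ (hE.smooth_density.isSmooth_slice h0mem).continuous h0Φ
  have hρ0lt : ∀ x, ρ 0 x < K := fun x => by
    rw [hρ0]; exact DenseExcursionAtTimeZero.rhoLim_lt hS x
  -- the sup norm of the density in time
  set m : ℝ → ℝ := fun s => (eSupNorm (ρ s)).toReal with hm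
  have hmcont : ContinuousOn m (Ico 0 T) := hE.smooth_density.continuousOn_toReal_eSupNorm
  have hle_m : ∀ s ∈ Ico 0 T, ∀ x, ρ s x ≤ m s := by
    intro s hs x
    have h := Torus.norm_le_toReal_eSupNorm (hE.smooth_density.isSmooth_slice hs).continuous x
    rw [Real.norm_eq_abs, abs_of_pos (hE.density_pos s hs x)] at h
    exact h
  have hm_le : ∀ s ∈ Ico 0 T, ∀ Bd : ℝ, 0 ≤ Bd → (∀ x, ρ s x ≤ Bd) → m s ≤ Bd := by
    intro s hs Bd hBd h
    have h1 : eSupNorm (ρ s) ≤ ENNReal.ofReal Bd :=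
      eSupNorm_le_ofReal fun x => by
        rw [Real.norm_eq_abs, abs_of_pos (hE.density_pos s hs x)]; exact h x
    exact (ENNReal.toReal_mono ENNReal.ofReal_ne_top h1).trans_eq (ENNReal.toReal_ofReal hBd)
  have hm0 : m 0 < L := (hm_le 0 h0mem K hK0.le fun x => (hρ0lt x).le).trans_lt hKL
  have htT : t ∈ Ico 0 T := ht
  by_cases hcase : ∀ s ∈ Icc 0 t, m s < L
  · -- CASE A: the guard level is not reached on `[0, t]`; extend slightly beyond `t` by continuity
    have hct : ContinuousWithinAt m (Ico 0 T) t := hmcont t htT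
    have hmt : m t < L := hcase t ⟨ht.1, le_rfl⟩
    obtain ⟨δ, hδ, hδm⟩ := Metric.continuousWithinAt_iff.1 hct (L - m t) (by linarith)
    set T' : ℝ := min T (t + δ) with hT'
    have hT'T : T' ≤ T := min_le_left _ _
    have htT' : t < T' := lt_min ht.2 (by linarith)
    have hE' : IsHardSphereEulerSolution σ T' ρ u θ := hE.restrict hT'T
    have hguard' : ∀ s ∈ Ico 0 T', ∀ x, ρ s x * σ ^ 3 < η := by
      intro s hs x
      have hsT : s ∈ Ico 0 T := ⟨hs.1, hs.2.trans_le hT'T⟩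
      have hms : m s < L := by
        rcases le_or_gt s t with hst | hst
        · exact hcase s ⟨hs.1, hst⟩
        · have hdist : dist s t < δ := by
            rw [Real.dist_eq, abs_lt]
            constructor <;> linarith [hs.2.trans_le (min_le_right T (t + δ))]
          have := hδm hsT hdist
          rw [Real.dist_eq, abs_lt] at this
          linarith [this.2]
      have h1 : ρ s x < L := (hle_m s hsT x).trans_lt hms
      rw [hL, lt_div_iff₀ hσ3pos] at h1
      linarith
    have hB := B σ hσ hσσ₀ T' ρ θ u hE' hguard' Φ h0Φ t ⟨ht.1, htT'⟩ x₀
    have : ρ t x₀ ≤ R' := hB.trans hRR'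
    linarith [hx₀, hpow]
  · -- CASE B: the guard level IS reached on `[0, t]`; restrict to the first such time
    push Not at hcase
    set S : Set ℝ := Icc 0 t ∩ m ⁻¹' (Ici L) with hSdef
    have hSne : S.Nonempty := by
      obtain ⟨s, hs, hms⟩ := hcase
      exact ⟨s, hs, hms⟩
    have hSbdd : BddBelow S := ⟨0, fun s hs => hs.1.1⟩
    have hSclosed : IsClosed S :=
      (hmcont.mono (Icc_subset_Ico_right ht.2)).preimage_isClosed_of_isClosed isClosed_Icc isClosed_Ici
    set sg : ℝ := sInf S with hsg
    have hsgS : sg ∈ S := hSclosed.csInf_mem hSne hSbdd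
    have hsg_le : ∀ s ∈ S, sg ≤ s := fun s hs => csInf_le hSbdd hs
    have hsgt : sg ≤ t := hsgS.1.2
    have hsg0 : 0 ≤ sg := hsgS.1.1
    have hsgT : sg ∈ Ico 0 T := ⟨hsg0, hsgt.trans_lt ht.2⟩
    have hmsg : L ≤ m sg := hsgS.2
    have hsgpos : 0 < sg := by
      rcases hsg0.lt_or_eq with h | h
      · exact h
      · exfalso; rw [← h] at hmsg; linarith [hm0]
    -- below `sg` the guard holds
    have hbelow : ∀ s ∈ Ico 0 sg, m s < L := by
      intro s hs
      by_contra hnot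
      push Not at hnot
      have hsS : s ∈ S := ⟨⟨hs.1, hs.2.le.trans hsgt⟩, hnot⟩
      exact absurd (hsg_le s hsS) (not_le.2 hs.2)
    have hE' : IsHardSphereEulerSolution σ sg ρ u θ := hE.restrict (hsgt.trans ht.2.le)
    have hguard' : ∀ s ∈ Ico 0 sg, ∀ x, ρ s x * σ ^ 3 < η := by
      intro s hs x
      have hsT : s ∈ Ico 0 T := ⟨hs.1, hs.2.trans_le (hsgt.trans ht.2.le)⟩
      have h1 : ρ s x < L := (hle_m s hsT x).trans_lt (hbelow s hs)
      rw [hL, lt_div_iff₀ hσ3pos] at h1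
      linarith
    have hBall : ∀ s ∈ Ico 0 sg, m s ≤ R' := by
      intro s hs
      have hsT : s ∈ Ico 0 T := ⟨hs.1, hs.2.trans_le (hsgt.trans ht.2.le)⟩
      exact hm_le s hsT R' hR'0 fun x => (B σ hσ hσσ₀ sg ρ θ u hE' hguard' Φ h0Φ s hs x).trans hRR'
    -- continuity of `m` at `sg` from the left contradicts `m ≤ R'` before `sg` and `m sg ≥ L > R' + 1`
    have hct : ContinuousWithinAt m (Ico 0 T) sg := hmcont sg hsgT
    obtain ⟨δ, hδ, hδm⟩ := Metric.continuousWithinAt_iff.1 hct 1 one_pos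
    set s : ℝ := max (sg - δ / 2) (sg / 2) with hsdef
    have hs_lt : s < sg := max_lt (by linarith) (by linarith)
    have hs_ge : 0 ≤ s := (le_max_right _ _).trans' (by linarith)
    have hs_mem : s ∈ Ico 0 sg := ⟨hs_ge, hs_lt⟩
    have hsT : s ∈ Ico 0 T := ⟨hs_ge, hs_lt.trans_le (hsgt.trans ht.2.le)⟩
    have hdist : dist s sg < δ := by
      rw [Real.dist_eq, abs_lt]
      constructor <;> linarith [le_max_left (sg - δ / 2) (sg / 2)]
    have hclose := hδm hsT hdist
    rw [Real.dist_eq, abs_lt] at hclose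
    have h1 : m s ≤ R' := hBall s hs_mem
    linarith [hclose.1]

/-- **Child B is FALSE, unconditionally** — `PolynomialCompression` is PROVED in the tree
(`polynomialCompression_proof`, p-lineage of stmt-12587 @ 02b87ed567e7). So the PDE/particle split of this crux has a
refuted child: the profile-wise packing guard does NOT confine the guarded class to bounded compressions. -/
theorem guardedDensityBound_false : ¬ GuardedDensityBound :=
  guardedDensityBound_false_of_polynomialCompression polynomialCompression_proof

end Summit.AtomisticToContinuum.HydrodynamicLimit.Cruxes.HydroLimitProfilewiseBand.Census

end
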